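import Summits.QuantumFields.YangMills.Theorems.UnitScaleTiltProp7B8Prop7Plaq
import Summits.QuantumFields.YangMills.Theorems.UnitScaleTiltProp7TPrintDefs
import HarnessLib

/-!
# Route `UnitScaleTilt`, crux «MinimiserStabilityRegPr» (stmt-QuantumFields-19200, stub EX), route (α) — **«PLAQ-CHART-POINT» (px16 g3 LOCATE «H128-CYCLE» 0b50e466fd265af9, cure (C3)):
# THE PLAQUETTE REGULARITY OF A CHART POINT `e^{iX}U₀` FROM THE FIRST TWO (19)-MEMBERS ONLY** (`‖X‖ < ε₂η`, `‖∇¹_{U₀}X‖ < ε₂η²`; NO `D*DX`, NO `ΔX`) — [Balaban1985RegularSpaces]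
# (1.47)∕Prop. 7 as ✓`Prop7B8Prop7Plaq.dist1_plaqHol_emb15_lt` proves it (that proof reads only `h19.1`, `h19.2.1`, `h19.2.2.1`, `h19.2.2.2.1`), re-cut so that the η⁻³ members are NOT
# hypotheses.  WHY: as typed, the `h128Δ` inhabitant chain closes a cycle through `RegPr U′` (bridge `hSplit′ ⟹ hSplit127` reads `RegPr ε₀′ U′`, whose supplier of record needs all of
# (19), i.e. (136)+(140) = `hΔsol ⟸ h128Δ`); print's (124)–(126) need only PLAQUETTE regularity of `U₁U₀` ([6] Sect. D's input), which the (115)-norm gives BEFORE (128) — this file is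
# that plaquette half; its member corollary for the knit's chart exponent follows by ★px18 ✓`Prop7Size19Orders01.orders01_of_eq111_T3` (orders 0, 1 from Prop. 6 + (20) + (46), no `hΔsol`).

Cell `ym3-torus` (HUMAN RULING D-0037, rung R3 — YM₃ on T³, NOT d = 4, NOT Clay; YM gap NOT proved), width seat `ym3-torus-px16` (gen 3).  THEOREMS ONLY (0 `def`, 0 `sorry`);
`--supports stmt-QuantumFields-19200 --as helper`, count-neutral; nothing of the stub∕crux∕gap claimed.

WHAT IS PROVED (ns `…Theorems.Prop7PlaqChartPointOfOrders01`).  §1 ★★`dist1_plaqHol_emb15_lt_of_orders01` — `|U₀(∂p) − 1| < aη²`, `X` Hermitian-traceless, `U₁ = e^{iX}`, `‖X‖ < ε₂η`,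
`‖∇¹_{U₀}X‖ < ε₂η²`, `ε₂ ≤ ¼` ⟹ `|(U₁U₀)(∂p) − 1| < (2a + 11ε₂)η²` (✓`dist1_plaqHol_emb15_lt`'s proof VERBATIM on the four facts).  §2 ★★`plaqSmall_emb15_of_orders01` — the `PlaqSmall` form:
`PlaqSmall (regThreshold a) U₀` ⟹ `PlaqSmall (regThreshold (2a + 11ε₂)) (emb15 U₀ U₁)`; ★★`plaqSmall_expHermField_of_orders01_le` — the same for `U₁ := expHermField X` from NON-STRICT
member bounds `≤ m·η`, `≤ m·η²` with `m < ε₂` (the shape ★px18's `orders01_of_eq111_T3` delivers).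
HONEST SCOPE: a re-cut of a landed estimate; no new analysis; the divergence clause `DivSmall` of `RegPr` is NOT supplied here (it IS (136)-class).

References: T. Bałaban, CMP **99** (1985) 75–102 [Balaban1985RegularSpaces] ((1.47) p.84, Prop. 7 p.98, (1.7)+(1.9) p.77); CMP **102** (1985) 277–309 [Balaban1985Variational] ((19) p.281,
(2) p.278, (124)–(126) p.296, p.299).
-/

set_option autoImplicit false

noncomputable section

namespace Summit.QuantumFields.YangMills.Theorems.Prop7PlaqChartPointOfOrders01

open Literature.MathematicalPhysics.QuantumFieldTheory.Balaban1983to89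
open Literature.MathematicalPhysics.QuantumFieldTheory.Balaban1983to89.T3ContinuumYM3Torus
open Literature.MathematicalPhysics.QuantumFieldTheory.Balaban1983to89.T3RegularMinimiser (regThreshold)
open Literature.MathematicalPhysics.QuantumFieldTheory.Balaban1983to89.T3LowerAlongMinimisersSplit (L_cast_pos)
open B10Eq27TorusAxialLog (toUField unitsField unitsField_mem_unitaryUnits val_unitsField)
open B7Eq78Linearization (conjR conjR_apply)
open T3Thm1Carrier
open T3SectALandauChart
open Summit.QuantumFields.YangMills.Theorems.Prop7CovariantCoercivity (norm_plaqHol_mul_star_bg_sub_one_sub_covCurl_le coe_inv_eq_star)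
open Summit.QuantumFields.YangMills.Theorems.Prop7B8Prop7Plaq (norm_exp_I_smul_sub_one_sub_le_sq norm_exp_I_smul_sub_one_le' coe_emb15_mul_star covGradT_one_bgUnits_eq eta_le_one)
open Summit.QuantumFields.YangMills.Theorems.Prop7TPrint (expHermField expHermField_apply coe_expHerm)
open NormedSpace

open scoped Matrix.Norms.L2Operator

/-! ## §1 (1.47) from the first two (19)-members -/

variable (F : T3Family) (n K : ℕ)

set_option maxHeartbeats 400000 in
/-- ★★ **[Balaban1985RegularSpaces] (1.47) AT THE T³ CARRIER FROM THE FIRST TWO (19)-MEMBERS ONLY** — ✓`Prop7B8Prop7Plaq.dist1_plaqHol_emb15_lt` re-cut with its `In19` hypothesis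
replaced by the four facts it actually reads: `X` Hermitian-traceless, `U₁ = e^{iX}` bondwise, `‖X‖ < ε₂η`, `‖∇¹_{U₀}X‖ < ε₂η²` (NO η⁻³ member: no `D*DX`, no `ΔX`); conclusion VERBATIM:
`|U₀(∂p) − 1| < aη²` ⟹ `|(U₁U₀)(∂p) − 1| < (2a + 11ε₂)η²`. [cite: Balaban1985RegularSpaces, (1.47) p.84, Prop. 7 p.98; Balaban1985Variational, (19) p.281, (2) p.278] -/
theorem dist1_plaqHol_emb15_lt_of_orders01 {ε₂ a : ℝ} (hε₂ : ε₂ ≤ 1 / 4) {U₀ U₁ : GaugeField (F.P K) 0 (Matrix.specialUnitaryGroup (Fin 2) ℂ)}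
    {X : PBond (F.P K) 0 → Matrix (Fin 2) (Fin 2) ℂ} (hXR : ∀ b : PBond (F.P K) 0, (X b).IsHermitian ∧ Matrix.trace (X b) = 0)
    (hU₁ : ∀ b : PBond (F.P K) 0, ((U₁ b : Matrix.specialUnitaryGroup (Fin 2) ℂ) : Matrix (Fin 2) (Fin 2) ℂ) = exp (Complex.I • X b))
    (hX0 : ∀ b : PBond (F.P K) 0, ‖X b‖ < ε₂ * eta F n K)
    (hX1 : ∀ (μ ν : Fin (F.P K).d) (x : Site (F.P K) 0), ‖covGradT 1 (bgUnits F K U₀) X μ ν x‖ < ε₂ * eta F n K ^ 2) (p : Plaq (F.P K) 0)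
    (hp : dist1 (GaugeField.plaqHol U₀ p) < a * eta F n K ^ 2) :
    dist1 (GaugeField.plaqHol (emb15 U₀ U₁) p) < (2 * a + 11 * ε₂) * eta F n K ^ 2 := by
  set η : ℝ := eta F n K with hηdef
  have hη : 0 < η := eta_pos F n K
  have hη1 : η ≤ 1 := eta_le_one F n K
  have hε₂0 : 0 < ε₂ := by
    have hb := hX0 ⟨default, ⟨0, (F.P K).hd⟩⟩
    exact (mul_pos_iff_of_pos_right hη).mp ((norm_nonneg _).trans_lt hb)
  have ha : 0 < a := by
    have := (GaugeGroup.dist1_nonneg _).trans_lt hp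
    exact (mul_pos_iff_of_pos_right (pow_pos hη 2)).mp this
  -- abbreviations (matrices)
  set b₁ : PBond (F.P K) 0 := ⟨p.src, p.μ⟩
  set b₂ : PBond (F.P K) 0 := ⟨p.src.shift p.μ, p.ν⟩
  set b₃ : PBond (F.P K) 0 := ⟨p.src.shift p.ν, p.μ⟩
  set b₄ : PBond (F.P K) 0 := ⟨p.src, p.ν⟩
  set u₁ : Matrix (Fin 2) (Fin 2) ℂ := ((U₀ b₁ : Matrix.specialUnitaryGroup (Fin 2) ℂ) : Matrix (Fin 2) (Fin 2) ℂ)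
  set u₄ : Matrix (Fin 2) (Fin 2) ℂ := ((U₀ b₄ : Matrix.specialUnitaryGroup (Fin 2) ℂ) : Matrix (Fin 2) (Fin 2) ℂ)
  set Y : PBond (F.P K) 0 → Matrix (Fin 2) (Fin 2) ℂ := fun b => ((U₁ b : Matrix.specialUnitaryGroup (Fin 2) ℂ) : Matrix (Fin 2) (Fin 2) ℂ) - 1 with hYdef
  set P : Matrix (Fin 2) (Fin 2) ℂ := ((GaugeField.plaqHol (emb15 U₀ U₁) p : Matrix.specialUnitaryGroup (Fin 2) ℂ) : Matrix (Fin 2) (Fin 2) ℂ)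
  set P₀ : Matrix (Fin 2) (Fin 2) ℂ := ((GaugeField.plaqHol U₀ p : Matrix.specialUnitaryGroup (Fin 2) ℂ) : Matrix (Fin 2) (Fin 2) ℂ)
  -- bond sizes from (19)
  have hYX : ∀ b, ‖Y b‖ ≤ ‖X b‖ := fun b => by
    simp only [hYdef, hU₁ b]; exact norm_exp_I_smul_sub_one_le' (hXR b).1
  have hXb : ∀ b, ‖X b‖ < ε₂ * η := hX0
  have hYb : ∀ b, ‖Y b‖ < ε₂ * η := fun b => (hYX b).trans_lt (hXb b)
  have hsmall : ε₂ * η ≤ 1 / 4 := by nlinarith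
  have hY1 : ∀ b, ‖Y b‖ ≤ 1 := fun b => by linarith [hYb b]
  have hRb : ∀ b, ‖Y b - Complex.I • X b‖ ≤ (ε₂ * η) ^ 2 / 2 := fun b => by
    have h1 : ‖Y b - Complex.I • X b‖ ≤ ‖X b‖ ^ 2 / 2 := by
      simp only [hYdef, hU₁ b]; exact norm_exp_I_smul_sub_one_sub_le_sq (hXR b).1
    have h2 : ‖X b‖ ^ 2 ≤ (ε₂ * η) ^ 2 := pow_le_pow_left₀ (norm_nonneg _) (hXb b).le 2
    linarith
  -- the expansion at the background (p1 lineage), fluctuation = U₁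
  have eW := coe_emb15_mul_star U₀ U₁
  have key := norm_plaqHol_mul_star_bg_sub_one_sub_covCurl_le (emb15 U₀ U₁) U₀ p (by rw [eW]; exact hY1 _) (by rw [eW]; exact hY1 _)
  simp only [eW] at key
  -- `key : ‖P * star P₀ - 1 - LIN‖ ≤ 2 (ΣY)^2 + 2 ‖P₀ - 1‖ (‖Y b₃‖ + ‖Y b₄‖)` with LIN = Y b₁ + u₁ Y b₂ u₁^* - u₄ Y b₃ u₄^* - Y b₄
  -- the linear term in `X`: a difference of two (19)-gradient entries
  have hG1 := hX1 p.μ p.ν p.src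
  have hG2 := hX1 p.ν p.μ p.src
  rw [covGradT_one_bgUnits_eq] at hG1 hG2
  have hLX : ‖Complex.I • X b₁ + u₁ * (Complex.I • X b₂) * star u₁ - u₄ * (Complex.I • X b₃) * star u₄ - Complex.I • X b₄‖ < 2 * ε₂ * η ^ 2 := by
    have e : Complex.I • X b₁ + u₁ * (Complex.I • X b₂) * star u₁ - u₄ * (Complex.I • X b₃) * star u₄ - Complex.I • X b₄
        = Complex.I • ((u₁ * X b₂ * star u₁ - X b₄) - (u₄ * X b₃ * star u₄ - X b₁)) := by
      simp only [smul_sub, mul_smul_comm, smul_mul_assoc]; abel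
    rw [e, norm_smul, Complex.norm_I, one_mul]
    exact (norm_sub_le _ _).trans_lt (by linarith)
  -- the one-factor remainders
  have hD : ‖(Y b₁ + u₁ * Y b₂ * star u₁ - u₄ * Y b₃ * star u₄ - Y b₄)
      - (Complex.I • X b₁ + u₁ * (Complex.I • X b₂) * star u₁ - u₄ * (Complex.I • X b₃) * star u₄ - Complex.I • X b₄)‖ ≤ 2 * (ε₂ * η) ^ 2 := by
    have e : (Y b₁ + u₁ * Y b₂ * star u₁ - u₄ * Y b₃ * star u₄ - Y b₄)
        - (Complex.I • X b₁ + u₁ * (Complex.I • X b₂) * star u₁ - u₄ * (Complex.I • X b₃) * star u₄ - Complex.I • X b₄)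
        = (Y b₁ - Complex.I • X b₁) + u₁ * (Y b₂ - Complex.I • X b₂) * star u₁ - u₄ * (Y b₃ - Complex.I • X b₃) * star u₄ - (Y b₄ - Complex.I • X b₄) := by
      simp only [mul_sub, sub_mul]; abel
    rw [e]
    have hu₁ : u₁ ∈ unitary (Matrix (Fin 2) (Fin 2) ℂ) := (U₀ b₁).2.1
    have hu₄ : u₄ ∈ unitary (Matrix (Fin 2) (Fin 2) ℂ) := (U₀ b₄).2.1
    have n2 : ‖u₁ * (Y b₂ - Complex.I • X b₂) * star u₁‖ = ‖Y b₂ - Complex.I • X b₂‖ := by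
      rw [CStarRing.norm_mul_mem_unitary _ (Unitary.star_mem hu₁), CStarRing.norm_mem_unitary_mul _ hu₁]
    have n3 : ‖u₄ * (Y b₃ - Complex.I • X b₃) * star u₄‖ = ‖Y b₃ - Complex.I • X b₃‖ := by
      rw [CStarRing.norm_mul_mem_unitary _ (Unitary.star_mem hu₄), CStarRing.norm_mem_unitary_mul _ hu₄]
    calc _ ≤ ‖Y b₁ - Complex.I • X b₁‖ + ‖u₁ * (Y b₂ - Complex.I • X b₂) * star u₁‖ + ‖u₄ * (Y b₃ - Complex.I • X b₃) * star u₄‖ + ‖Y b₄ - Complex.I • X b₄‖ := by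
          refine (norm_sub_le _ _).trans ?_
          refine add_le_add ((norm_sub_le _ _).trans (add_le_add ((norm_add_le _ _).trans le_rfl) le_rfl)) le_rfl
      _ ≤ (ε₂ * η) ^ 2 / 2 + (ε₂ * η) ^ 2 / 2 + (ε₂ * η) ^ 2 / 2 + (ε₂ * η) ^ 2 / 2 := by
          rw [n2, n3]; exact add_le_add (add_le_add (add_le_add (hRb _) (hRb _)) (hRb _)) (hRb _)
      _ = 2 * (ε₂ * η) ^ 2 := by ring
  -- the linear term in `Y`
  have hLY : ‖Y b₁ + u₁ * Y b₂ * star u₁ - u₄ * Y b₃ * star u₄ - Y b₄‖ < 2 * ε₂ * η ^ 2 + 2 * (ε₂ * η) ^ 2 := by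
    have := norm_sub_le_norm_sub_add_norm_sub (Y b₁ + u₁ * Y b₂ * star u₁ - u₄ * Y b₃ * star u₄ - Y b₄)
      (Complex.I • X b₁ + u₁ * (Complex.I • X b₂) * star u₁ - u₄ * (Complex.I • X b₃) * star u₄ - Complex.I • X b₄) 0
    rw [sub_zero, sub_zero] at this
    linarith
  -- the background plaquette
  have hP₀ : ‖P₀ - 1‖ < a * η ^ 2 := hp
  -- assemble `‖P·P₀^* − 1‖`
  have hQ : ‖P * star P₀ - 1‖ < 2 * ε₂ * η ^ 2 + 2 * (ε₂ * η) ^ 2 + 2 * (4 * (ε₂ * η)) ^ 2 + 2 * (a * η ^ 2) * (2 * (ε₂ * η)) := by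
    have hsum : ‖Y b₁‖ + ‖Y b₂‖ + ‖Y b₃‖ + ‖Y b₄‖ < 4 * (ε₂ * η) := by linarith [hYb b₁, hYb b₂, hYb b₃, hYb b₄]
    have hsum0 : 0 ≤ ‖Y b₁‖ + ‖Y b₂‖ + ‖Y b₃‖ + ‖Y b₄‖ := by positivity
    have hsq : (‖Y b₁‖ + ‖Y b₂‖ + ‖Y b₃‖ + ‖Y b₄‖) ^ 2 ≤ (4 * (ε₂ * η)) ^ 2 := pow_le_pow_left₀ hsum0 hsum.le 2
    have h34 : ‖Y b₃‖ + ‖Y b₄‖ ≤ 2 * (ε₂ * η) := by linarith [hYb b₃, hYb b₄]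
    have hcurv : 2 * ‖P₀ - 1‖ * (‖Y b₃‖ + ‖Y b₄‖) ≤ 2 * (a * η ^ 2) * (2 * (ε₂ * η)) := by
      have h1 : 0 ≤ ‖P₀ - 1‖ := norm_nonneg _
      have h2 : 0 ≤ ‖Y b₃‖ + ‖Y b₄‖ := by positivity
      nlinarith
    have htri : ‖P * star P₀ - 1‖ ≤ ‖Y b₁ + u₁ * Y b₂ * star u₁ - u₄ * Y b₃ * star u₄ - Y b₄‖
        + ‖P * star P₀ - 1 - (Y b₁ + u₁ * Y b₂ * star u₁ - u₄ * Y b₃ * star u₄ - Y b₄)‖ := by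
      have := norm_add_le (Y b₁ + u₁ * Y b₂ * star u₁ - u₄ * Y b₃ * star u₄ - Y b₄)
        (P * star P₀ - 1 - (Y b₁ + u₁ * Y b₂ * star u₁ - u₄ * Y b₃ * star u₄ - Y b₄))
      rwa [add_sub_cancel] at this
    linarith
  -- back to `‖P − 1‖`: `P − 1 = (P·P₀^* − 1)·P₀ + (P₀ − 1)`
  have hP₀u : P₀ ∈ unitary (Matrix (Fin 2) (Fin 2) ℂ) := (GaugeField.plaqHol U₀ p).2.1
  have eP : P - 1 = (P * star P₀ - 1) * P₀ + (P₀ - 1) := by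
    have h := Unitary.star_mul_self_of_mem hP₀u
    calc P - 1 = P * (star P₀ * P₀) - 1 := by rw [h, mul_one]
      _ = (P * star P₀ - 1) * P₀ + (P₀ - 1) := by noncomm_ring
  have hfin : ‖P - 1‖ ≤ ‖P * star P₀ - 1‖ + ‖P₀ - 1‖ := by
    rw [eP]
    refine (norm_add_le _ _).trans (add_le_add (le_of_eq ?_) le_rfl)
    exact CStarRing.norm_mul_mem_unitary _ hP₀u
  show ‖P - 1‖ < (2 * a + 11 * ε₂) * η ^ 2
  have hnum : 2 * ε₂ * η ^ 2 + 2 * (ε₂ * η) ^ 2 + 2 * (4 * (ε₂ * η)) ^ 2 + 2 * (a * η ^ 2) * (2 * (ε₂ * η)) + a * η ^ 2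
      ≤ (2 * a + 11 * ε₂) * η ^ 2 := by
    have h1 : (ε₂ * η) ^ 2 ≤ ε₂ * η ^ 2 / 4 := by nlinarith
    have h2 : 2 * (a * η ^ 2) * (2 * (ε₂ * η)) ≤ a * η ^ 2 := by
      have : 4 * (ε₂ * η) ≤ 1 := by linarith
      have h0 : 0 ≤ a * η ^ 2 := by positivity
      nlinarith
    nlinarith
  linarith

/-! ## §2 The `PlaqSmall` forms -/

variable {F n K}

/-- ★★ **`U₁U₀` PLAQUETTE-REGULAR at radius `2a + 11ε₂` from `U₀` plaquette-regular at radius `a` and the first two (19)-members of `X`** (`U₁ = e^{iX}`).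
[cite: Balaban1985RegularSpaces, (1.47) p.84, Prop. 7 p.98; Balaban1985Variational, (2) p.278, (19) p.281] -/
theorem plaqSmall_emb15_of_orders01 {ε₂ a : ℝ} (hε₂ : ε₂ ≤ 1 / 4) {U₀ U₁ : GaugeField (F.P K) 0 (Matrix.specialUnitaryGroup (Fin 2) ℂ)}
    {X : PBond (F.P K) 0 → Matrix (Fin 2) (Fin 2) ℂ} (hU₀ : PlaqSmall (regThreshold F n K a) U₀)
    (hXR : ∀ b : PBond (F.P K) 0, (X b).IsHermitian ∧ Matrix.trace (X b) = 0)
    (hU₁ : ∀ b : PBond (F.P K) 0, ((U₁ b : Matrix.specialUnitaryGroup (Fin 2) ℂ) : Matrix (Fin 2) (Fin 2) ℂ) = exp (Complex.I • X b))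
    (hX0 : ∀ b : PBond (F.P K) 0, ‖X b‖ < ε₂ * eta F n K)
    (hX1 : ∀ (μ ν : Fin (F.P K).d) (x : Site (F.P K) 0), ‖covGradT 1 (bgUnits F K U₀) X μ ν x‖ < ε₂ * eta F n K ^ 2) :
    PlaqSmall (regThreshold F n K (2 * a + 11 * ε₂)) (emb15 U₀ U₁) := by
  intro p
  have e : ∀ c : ℝ, regThreshold F n K c = c * eta F n K ^ 2 := fun c => by
    rw [eta_pow]; rfl
  rw [e]
  exact dist1_plaqHol_emb15_lt_of_orders01 F n K hε₂ hXR hU₁ hX0 hX1 p (by rw [← e]; exact hU₀ p)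

/-- ★★ **THE CHART POINT `emb15 U₀ (expHermField X)` IS PLAQUETTE-REGULAR at radius `2a + 11ε₂`** from `PlaqSmall (regThreshold a) U₀`, `X` Hermitian-traceless and NON-STRICT first-order
sizes `‖X b‖ ≤ m·η`, `‖∇¹_{U₀}X‖ ≤ m·η²` with `m < ε₂ ≤ ¼` — the shape ★px18 ✓`Prop7Size19Orders01.orders01_of_eq111_T3` delivers for the knit's exponent (Prop. 6 + (20) + (46); NO `hΔsol`),
so the bridge's `U′`-regularity (plaquette half) is available BEFORE (128).  [cite: Balaban1985RegularSpaces, Prop. 7 p.98; Balaban1985Variational, (19) p.281, (124)–(126) p.296, p.299] -/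
theorem plaqSmall_expHermField_of_orders01_le {ε₂ a m : ℝ} (hε₂ : ε₂ ≤ 1 / 4) (hm : m < ε₂) {U₀ : GaugeField (F.P K) 0 (Matrix.specialUnitaryGroup (Fin 2) ℂ)}
    {X : PBond (F.P K) 0 → Matrix (Fin 2) (Fin 2) ℂ} (hU₀ : PlaqSmall (regThreshold F n K a) U₀)
    (hXR : ∀ b : PBond (F.P K) 0, (X b).IsHermitian ∧ Matrix.trace (X b) = 0)
    (hX0 : ∀ b : PBond (F.P K) 0, ‖X b‖ ≤ m * eta F n K)
    (hX1 : ∀ (μ ν : Fin (F.P K).d) (x : Site (F.P K) 0), ‖covGradT 1 (bgUnits F K U₀) X μ ν x‖ ≤ m * eta F n K ^ 2) :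
    PlaqSmall (regThreshold F n K (2 * a + 11 * ε₂)) (emb15 U₀ (expHermField X)) := by
  have hη : 0 < eta F n K := eta_pos F n K
  refine plaqSmall_emb15_of_orders01 hε₂ hU₀ hXR (fun b => ?_) (fun b => ?_) (fun μ ν x => ?_)
  · rw [expHermField_apply, coe_expHerm (hXR b)]
  · exact (hX0 b).trans_lt (mul_lt_mul_of_pos_right hm hη)
  · exact (hX1 μ ν x).trans_lt (mul_lt_mul_of_pos_right hm (pow_pos hη 2))

end Summit.QuantumFields.YangMills.Theorems.Prop7PlaqChartPointOfOrders01

end
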